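import Mathlib
import Literature.Barriers.ValiantsHypothesis.AlgebraicNaturalProofs
import Literature.Computability.AlgebraicComplexity.ArithCircuitProofs
import Literature.Computability.AlgebraicComplexity.IMMInVPProofs
import Literature.Computability.AlgebraicComplexity.HomogeneousComponentsComplexity
import Summits.ValiantsHypothesis.ValiantsHypothesis.Theorems.BarrierLeverSuccinctHittingSetsForVPHomogeneous
import Summits.ValiantsHypothesis.ValiantsHypothesis.Theorems.BarrierLeverSuccinctHittingSetsForVPHeart
import Summits.ValiantsHypothesis.ValiantsHypothesis.Theorems.BarrierLeverSuccinctHittingSetsForVPSparse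
import Summits.ValiantsHypothesis.ValiantsHypothesis.Theorems.BarrierLeverSuccinctHittingSetsForVPStubMultilinearCoords
import Summits.ValiantsHypothesis.ValiantsHypothesis.Theorems.BarrierLeverSuccinctHittingSetsForVPIsobaricComponents
import HarnessLib

/-!
# Crux `BarrierLever.SuccinctHittingSetsForVP` (stmt-ValiantsHypothesis-14610), line `registered` —
THE ISOBARIC REDUCTION: EQUATIONS FOR `VP` MAY BE ASSUMED BIHOMOGENEOUS AND SUPER-DENSE
(registered stub `stub_isobaricReduction`, wave 8)

**What is proved (unconditional; a REDUCTION of the open heart, it does NOT close the item).**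
In FSV's framework over `ℂ` (regime `d = n`; coefficient variables `c_μ` indexed by
`degLEMonomials n`, `N = C(2n,n)` of them) grade the coefficient variables by the degree of the
exponent vector, `wt(c_μ) := |μ|`. A distinguisher is *isobaric* if it is weighted homogeneous for
this weight, and *bihomogeneous* if it is homogeneous and isobaric.

* `levelFourHomogeneous_of_isobaric` (= registered stub `stub_isobaricReduction`) : if for some `b`,
  eventually in `n`, `SmallCircuits ℂ n b` hits every nonzero distinguisher that is SIMULTANEOUSLY of
  level `16`, homogeneous, `|μ|`-isobaric and super-dense (`> 2^(n^(b-3))` monomials), then it hits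
  (with size exponent `max b 4 + 1`) every nonzero HOMOGENEOUS level-4 distinguisher — which by the
  landed homogeneous reduction (`succinctHittingSetsForVP_iff_homogeneous`, p164794) is the crux.
* `succinctHittingSetsForVP_iff_isobaric` : hence the crux is EQUIVALENT to that statement.
* `exists_isobaric_equation` : contrapositive at fixed `n` — a homogeneous level-4 equation `E` for
  `SmallCircuits ℂ n (b+1)` (`n ≥ 4`, `b ≥ 1`) has a nonzero ISOBARIC COMPONENT, and every isobaric
  component of `E` is a bihomogeneous level-16 equation for `SmallCircuits ℂ n b`.

**Proof** (the argument of the homogeneous reduction with the torus `x ↦ t x` on the VARIABLES in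
place of the scaling `f ↦ t f`; toolkit in `…SuccinctHittingSetsForVPIsobaricComponents.lean`).
(1) `SmallCircuits` is closed under `f(x) ↦ f(t x)` up to one size exponent
(`Isobaric.aeval_C_mul_X_mem_smallCircuits`: substitute `C t * X i` for `X i`, `n` extra gates by
Bürgisser's substitution bound), and `coeff_μ f(tx) = t^|μ| coeff_μ f`. (2) On the torus orbit
`t ↦ (t^|μ| c_μ)_μ` a distinguisher `E` restricts to the univariate polynomial `Σ_k t^k E_k(c)`, `E_k`
the ISOBARIC COMPONENTS; so if `E` vanishes at `coeff f(tx)` for all `t`, every `E_k` vanishes at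
`coeff f` (`Isobaric.eval_weightedHomogeneousComponent_eq_zero`). (3) An isobaric component of a
homogeneous level-4 distinguisher is a level-16 distinguisher
(`Isobaric.weightedHomogeneousComponent_mem_distinguishers`): by the one-auxiliary-variable lift and
Strassen's homogenisation (`Isobaric.complexity_weightedHomogeneousComponent_le`) its size is
`≤ (d+k+2)² (N⁴ + |degLEMonomials n| (n+1)) ≤ 8 N¹⁴ ≤ N¹⁶` (`|degLEMonomials n| ≤ 8^n ≤ N³`,
`n + 1 ≤ N`, `d ≤ N⁴`, `k ≤ n d`). (4) An equation of `SmallCircuits ℂ n b` (`n, b ≥ 4`) has more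
than `2^(n^(b-3))` monomials (`Sparse.two_pow_pow_lt_card_support_of_vanishes`, FSV Cor. 34), so the
hypothesis hits it — contradiction. Axioms: `propext`, `Classical.choice`, `Quot.sound`.

References: [ForbesShpilkaVolk2018] Question 6, §1.2, Cor. 34; [Burgisser2000] Rem. 2.7;
[BurgisserClausenShokrollahi1997] (21.25).
-/

-- layout Summits/ValiantsHypothesis/ValiantsHypothesis forces the duplicated namespace component
set_option linter.dupNamespace false

namespace Summit.ValiantsHypothesis.ValiantsHypothesis.Theorems.BarrierLever.SuccinctHittingSetsForVP

open Literature.Barriers.ValiantsHypothesis Literature.Computability.AlgebraicComplexity MvPolynomial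

namespace Isobaric

/-! ### The torus on the variables preserves the simple class -/

/-- **Torus closure of the simple class**: `f(t x) ∈ SmallCircuits ℂ n (b+1)` whenever
`f ∈ SmallCircuits ℂ n b`, `n ≥ 2`, `b ≥ 1` (substitute `t x_i` for `x_i`: `n` extra gates,
`n^b + n ≤ n^{b+1}`). [cite: ForbesShpilkaVolk2018, Cor. 5] -/
theorem aeval_C_mul_X_mem_smallCircuits {n b : ℕ} (hn : 2 ≤ n) (hb : 1 ≤ b)
    {f : MvPolynomial (Fin n) ℂ} (hf : f ∈ SmallCircuits ℂ n b) (t : ℂ) :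
    aeval (fun i => (C t * X i : MvPolynomial (Fin n) ℂ)) f ∈ SmallCircuits ℂ n (b + 1) := by
  refine ⟨(totalDegree_aeval_C_mul_X_le t f).trans hf.1, ?_⟩
  have hgate : ∀ i : Fin n, complexity (C t * X i : MvPolynomial (Fin n) ℂ) ≤ 1 := fun i =>
    calc complexity (C t * X i : MvPolynomial (Fin n) ℂ)
        ≤ complexity (C t : MvPolynomial (Fin n) ℂ) + complexity (X i : MvPolynomial (Fin n) ℂ) + 1 :=
          complexity_mul_le_holds _ _
      _ = 1 := by rw [complexity_C_holds, complexity_X_holds]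
  have hnb : n ≤ n ^ b := by
    calc n = n ^ 1 := (pow_one n).symm
      _ ≤ n ^ b := Nat.pow_le_pow_right (by omega) hb
  calc complexity (aeval (fun i => (C t * X i : MvPolynomial (Fin n) ℂ)) f)
      ≤ complexity f + ∑ i : Fin n, complexity (C t * X i : MvPolynomial (Fin n) ℂ) :=
        complexity_aeval_le _ _
    _ ≤ n ^ b + ∑ _i : Fin n, 1 := Nat.add_le_add hf.2 (Finset.sum_le_sum fun i _ => hgate i)
    _ = n ^ b + n := by
        rw [Finset.sum_const, Finset.card_univ, Fintype.card_fin, smul_eq_mul, mul_one]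
    _ ≤ n ^ b + n ^ b := Nat.add_le_add_left hnb _
    _ ≤ n ^ (b + 1) := by rw [pow_succ]; nlinarith

/-- **The coefficient vector of `f(t x)`** is `(t^{|μ|} coeff_μ f)_μ`. [folklore] -/
theorem coeffVector_aeval_C_mul_X {n : ℕ} (t : ℂ) (f : MvPolynomial (Fin n) ℂ) :
    coeffVector (degLEMonomials n) (aeval (fun i => (C t * X i : MvPolynomial (Fin n) ℂ)) f) =
      fun μ => t ^ (fun μ : degLEMonomials n => (μ : Fin n →₀ ℕ).degree) μ *
        coeffVector (degLEMonomials n) f μ := by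
  funext μ
  simp only [coeffVector_apply, coeff_aeval_C_mul_X]

/-! ### Numerics for the coefficient space `degLEMonomials n` -/

/-- Crude count of the coefficient variables: `|degLEMonomials n| ≤ Σ_{d ≤ n} C(n+d-1, d) ≤
(n+1) 4^n ≤ 8^n`. [folklore] -/
theorem card_degLEMonomials_le (n : ℕ) [Fintype (degLEMonomials n)] :
    Fintype.card (degLEMonomials n) ≤ 8 ^ n := by
  -- adapted from the route file Theses/BarrierLever.lean (proof of `closes`)
  classical
  set S : Finset (Fin n →₀ ℕ) :=
    (Finset.range (n + 1)).biUnion fun d => Finset.univ.finsuppAntidiag d with hS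
  have hsub : degLEMonomials n ⊆ ↑S := by
    intro x hx
    simp only [degLEMonomials, Set.mem_setOf_eq] at hx
    refine Finset.mem_coe.2 (Finset.mem_biUnion.2 ⟨x.degree, Finset.mem_range.2 (by omega), ?_⟩)
    exact Finset.mem_finsuppAntidiag.2 ⟨(Finsupp.degree_eq_sum x).symm, Finset.subset_univ _⟩
  have hcard : S.card ≤ 8 ^ n := by
    refine Finset.card_biUnion_le.trans ?_
    calc ∑ d ∈ Finset.range (n + 1), (Finset.univ.finsuppAntidiag d).card
        ≤ ∑ _d ∈ Finset.range (n + 1), 4 ^ n := by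
          refine Finset.sum_le_sum fun d hd => ?_
          rw [Finset.card_finsuppAntidiag_nat_eq_choose, Finset.card_univ, Fintype.card_fin]
          have hd' : d ≤ n := Nat.lt_succ_iff.mp (Finset.mem_range.mp hd)
          calc (n + d - 1).choose d ≤ 2 ^ (n + d - 1) := Nat.choose_le_two_pow _ _
            _ ≤ 2 ^ (2 * n) := Nat.pow_le_pow_right (by norm_num) (by omega)
            _ = 4 ^ n := by rw [pow_mul]; norm_num
      _ = (n + 1) * 4 ^ n := by rw [Finset.sum_const, Finset.card_range, smul_eq_mul]
      _ ≤ 2 ^ n * 4 ^ n := Nat.mul_le_mul_right _ (Nat.succ_le_of_lt Nat.lt_two_pow_self)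
      _ = 8 ^ n := by rw [← mul_pow]; norm_num
  rw [← Set.toFinset_card]
  exact (Finset.card_le_card (Set.toFinset_subset.mpr hsub)).trans hcard

/-- The weight `|μ|` of a monomial in the coefficient variables is at most `n` times its degree.
[folklore] -/
theorem weight_degree_le {n : ℕ} (m : degLEMonomials n →₀ ℕ) :
    Finsupp.weight (fun μ : degLEMonomials n => (μ : Fin n →₀ ℕ).degree) m ≤ n * m.degree := by
  rw [Finsupp.weight_apply, Finsupp.sum, Finsupp.degree_apply, Finset.mul_sum]
  refine Finset.sum_le_sum fun μ _ => ?_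
  rw [smul_eq_mul, mul_comm]
  exact Nat.mul_le_mul_right _ (show (μ : Fin n →₀ ℕ).degree ≤ n from μ.2)

/-- **An isobaric component of a homogeneous level-4 distinguisher is a level-16 distinguisher**
(`n ≥ 4`, weight `k ≤ n · deg`): size `≤ (d+k+2)² (N⁴ + 8^n (n+1)) ≤ 8 N¹⁴ ≤ N¹⁶`, degree
`≤ d ≤ N⁴`. [cite: ForbesShpilkaVolk2018, §1.2] -/
theorem weightedHomogeneousComponent_mem_distinguishers {n : ℕ} (hn : 4 ≤ n)
    {E : MvPolynomial (degLEMonomials n) ℂ} (hE : E ∈ Distinguishers ℂ n 4)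
    (hhom : E.IsHomogeneous E.totalDegree) {k : ℕ} (hk : k ≤ n * E.totalDegree) :
    weightedHomogeneousComponent (fun μ : degLEMonomials n => (μ : Fin n →₀ ℕ).degree) k E ∈
      Distinguishers ℂ n 16 := by
  classical
  haveI : Fintype (degLEMonomials n) := (MultilinearCoords.finite_degLEMonomials n).fintype
  obtain ⟨hL, hdeg⟩ := hE
  have h2N : 2 ^ n ≤ Nat.choose (2 * n) n := LowDegreeEquations.two_pow_le_choose hn
  simp only [Distinguishers, Set.mem_setOf_eq]
  generalize Nat.choose (2 * n) n = N at hL hdeg h2N ⊢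
  have h16 : (16 : ℕ) ≤ 2 ^ n :=
    le_trans (by norm_num) (Nat.pow_le_pow_right (by norm_num) hn : 2 ^ 4 ≤ 2 ^ n)
  have hN16 : 16 ≤ N := h16.trans h2N
  have hn1N : n + 1 ≤ N := (Nat.succ_le_of_lt Nat.lt_two_pow_self).trans h2N
  have hNpos : 0 < N := by omega
  refine ⟨?_, ?_⟩
  · -- size
    have hcard : Fintype.card (degLEMonomials n) ≤ N ^ 3 := by
      calc Fintype.card (degLEMonomials n) ≤ 8 ^ n := card_degLEMonomials_le n
        _ = (2 ^ n) ^ 3 := by rw [← pow_mul, mul_comm, pow_mul]; norm_num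
        _ ≤ N ^ 3 := Nat.pow_le_pow_left h2N 3
    have hsum : ∑ μ : degLEMonomials n, ((μ : Fin n →₀ ℕ).degree + 1) ≤ N ^ 4 := by
      calc ∑ μ : degLEMonomials n, ((μ : Fin n →₀ ℕ).degree + 1)
          ≤ ∑ _μ : degLEMonomials n, (n + 1) :=
            Finset.sum_le_sum fun μ _ =>
              Nat.add_le_add_right (show (μ : Fin n →₀ ℕ).degree ≤ n from μ.2) 1
        _ = Fintype.card (degLEMonomials n) * (n + 1) := by
            rw [Finset.sum_const, Finset.card_univ, smul_eq_mul]
        _ ≤ N ^ 3 * N := Nat.mul_le_mul hcard hn1N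
        _ = N ^ 4 := by ring
    have h1 : (n + 1) * E.totalDegree ≤ N * N ^ 4 := Nat.mul_le_mul hn1N hdeg
    have h5 : 16 ≤ N ^ 5 := hN16.trans (Nat.le_self_pow (by norm_num) N)
    have hA : E.totalDegree + k + 2 ≤ 2 * N ^ 5 := by
      calc E.totalDegree + k + 2 ≤ (n + 1) * E.totalDegree + 2 := by rw [Nat.succ_mul]; omega
        _ ≤ N * N ^ 4 + 2 := Nat.add_le_add_right h1 2
        _ = N ^ 5 + 2 := by ring
        _ ≤ 2 * N ^ 5 := by linarith
    have hB : (E.totalDegree + k + 2) ^ 2 ≤ 4 * N ^ 10 := by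
      calc (E.totalDegree + k + 2) ^ 2 ≤ (2 * N ^ 5) ^ 2 := Nat.pow_le_pow_left hA 2
        _ = 4 * N ^ 10 := by ring
    have hC : complexity E + ∑ μ : degLEMonomials n, ((μ : Fin n →₀ ℕ).degree + 1) ≤
        2 * N ^ 4 := by
      calc complexity E + ∑ μ : degLEMonomials n, ((μ : Fin n →₀ ℕ).degree + 1)
          ≤ N ^ 4 + N ^ 4 := Nat.add_le_add hL hsum
        _ = 2 * N ^ 4 := by ring
    have h8 : 8 ≤ N ^ 2 := by nlinarith
    calc complexity (weightedHomogeneousComponent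
            (fun μ : degLEMonomials n => (μ : Fin n →₀ ℕ).degree) k E)
        = complexity (weightedHomogeneousComponent
            (fun μ : degLEMonomials n => 1 + (μ : Fin n →₀ ℕ).degree) (E.totalDegree + k) E) := by
          rw [weightedHomogeneousComponent_one_add hhom]
      _ ≤ (E.totalDegree + k + 2) ^ 2 *
            (complexity E + ∑ μ : degLEMonomials n, ((μ : Fin n →₀ ℕ).degree + 1)) :=
          complexity_weightedHomogeneousComponent_le _ E (E.totalDegree + k)
      _ ≤ 4 * N ^ 10 * (2 * N ^ 4) := Nat.mul_le_mul hB hC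
      _ = 8 * N ^ 14 := by ring
      _ ≤ N ^ 2 * N ^ 14 := Nat.mul_le_mul_right _ h8
      _ = N ^ 16 := by ring
  · -- degree
    calc (weightedHomogeneousComponent
            (fun μ : degLEMonomials n => (μ : Fin n →₀ ℕ).degree) k E).totalDegree
        ≤ E.totalDegree := (isHomogeneous_weightedHomogeneousComponent hhom _ k).totalDegree_le
      _ ≤ N ^ 4 := hdeg
      _ ≤ N ^ 16 := Nat.pow_le_pow_right hNpos (by norm_num)

end Isobaric

open Isobaric

/-- **A bihomogeneous level-16 equation from a homogeneous level-4 equation** (`n ≥ 4`, `b ≥ 1`):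
if a nonzero homogeneous level-4 `E` vanishes on `SmallCircuits ℂ n (b+1)`, then every isobaric
component of `E` vanishes on `SmallCircuits ℂ n b` (restrict to the torus `f(tx)`), and the
isobaric component through any monomial of `E` is a nonzero, homogeneous, `|μ|`-isobaric level-16
distinguisher. [cite: ForbesShpilkaVolk2018, Question 6 and §1.2] -/
theorem exists_isobaric_equation {n b : ℕ} (hn : 4 ≤ n) (hb : 1 ≤ b)
    {E : MvPolynomial (degLEMonomials n) ℂ} (hE : E ∈ Distinguishers ℂ n 4)
    (hhom : E.IsHomogeneous E.totalDegree) (hE0 : E ≠ 0)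
    (hvan : ∀ f ∈ SmallCircuits ℂ n (b + 1), eval (coeffVector (degLEMonomials n) f) E = 0) :
    ∃ F ∈ Distinguishers ℂ n 16, F ≠ 0 ∧ F.IsHomogeneous F.totalDegree ∧
      (∃ k : ℕ, F.IsWeightedHomogeneous (fun μ : degLEMonomials n => (μ : Fin n →₀ ℕ).degree) k) ∧
      ∀ f ∈ SmallCircuits ℂ n b, eval (coeffVector (degLEMonomials n) f) F = 0 := by
  classical
  -- a monomial of `E`, its weight `k`, and the isobaric component `F` through it
  obtain ⟨m, hm⟩ := exists_coeff_ne_zero hE0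
  refine ⟨weightedHomogeneousComponent (fun μ : degLEMonomials n => (μ : Fin n →₀ ℕ).degree)
      (Finsupp.weight (fun μ : degLEMonomials n => (μ : Fin n →₀ ℕ).degree) m) E,
    weightedHomogeneousComponent_mem_distinguishers hn hE hhom ?_, ?_, ?_,
    ⟨_, weightedHomogeneousComponent_isWeightedHomogeneous _ E⟩, ?_⟩
  · -- the weight of a monomial of `E` is at most `n · deg E`
    have hdm : m.degree = E.totalDegree := by
      rw [Finsupp.degree_apply, ← hhom.degree_eq_sum_deg_support (mem_support_iff.mpr hm)]
    calc Finsupp.weight (fun μ : degLEMonomials n => (μ : Fin n →₀ ℕ).degree) m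
        ≤ n * m.degree := weight_degree_le m
      _ = n * E.totalDegree := by rw [hdm]
  · -- nonzero: it contains the monomial `m`
    intro h0
    apply hm
    have hFm := coeff_weightedHomogeneousComponent
      (w := fun μ : degLEMonomials n => (μ : Fin n →₀ ℕ).degree)
      (Finsupp.weight (fun μ : degLEMonomials n => (μ : Fin n →₀ ℕ).degree) m) E m
    rw [if_pos rfl, h0, coeff_zero] at hFm
    exact hFm.symm
  · -- homogeneous (of the degree of `E`)
    have hFd := isHomogeneous_weightedHomogeneousComponent hhom
      (fun μ : degLEMonomials n => (μ : Fin n →₀ ℕ).degree)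
      (Finsupp.weight (fun μ : degLEMonomials n => (μ : Fin n →₀ ℕ).degree) m)
    by_cases h0 : weightedHomogeneousComponent (fun μ : degLEMonomials n => (μ : Fin n →₀ ℕ).degree)
        (Finsupp.weight (fun μ : degLEMonomials n => (μ : Fin n →₀ ℕ).degree) m) E = 0
    · rw [h0]; exact isHomogeneous_zero _ _ _
    · rw [hFd.totalDegree h0]; exact hFd
  · -- vanishing on `SmallCircuits ℂ n b`: restrict `E` to the torus `f(t x)`
    intro f hf
    refine eval_weightedHomogeneousComponent_eq_zero (fun t => ?_) _
    rw [← coeffVector_aeval_C_mul_X]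
    exact hvan _ (aeval_C_mul_X_mem_smallCircuits (by omega) hb hf t)

/-- **Homogeneous level four from the bihomogeneous super-dense level sixteen.** If for some `b`,
eventually in `n`, `SmallCircuits ℂ n b` hits every nonzero distinguisher of level `16` that is
homogeneous, `|μ|`-isobaric and has more than `2^(n^(b-3))` monomials, then (with size exponent
`max b 4 + 1`) it hits every nonzero homogeneous level-4 distinguisher: otherwise some homogeneous
level-4 `E ≠ 0` vanishes on `SmallCircuits ℂ n (b'+1)`, an isobaric component `F ≠ 0` of it is a
bihomogeneous level-16 equation of `SmallCircuits ℂ n b'` (`exists_isobaric_equation`), hence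
super-dense (`Sparse.two_pow_pow_lt_card_support_of_vanishes`), hence hit — contradiction.
[cite: ForbesShpilkaVolk2018, Question 6 and Cor. 34] -/
theorem levelFourHomogeneous_of_isobaric
    (h : ∃ b n₀ : ℕ, ∀ n : ℕ, n₀ ≤ n →
      IsSuccinctHittingSet (degLEMonomials n) (SmallCircuits ℂ n b)
        (Distinguishers ℂ n 16 ∩ {D | D.IsHomogeneous D.totalDegree} ∩
          {D | ∃ k : ℕ, D.IsWeightedHomogeneous (fun μ : degLEMonomials n => (μ : Fin n →₀ ℕ).degree) k} ∩
          {D | 2 ^ (n ^ (b - 3)) < D.support.card})) :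
    ∃ b n₀ : ℕ, ∀ n : ℕ, n₀ ≤ n →
      IsSuccinctHittingSet (degLEMonomials n) (SmallCircuits ℂ n b)
        (Distinguishers ℂ n 4 ∩ {D | D.IsHomogeneous D.totalDegree}) := by
  obtain ⟨b, n₀, hb⟩ := h
  -- move to b' = max b 4 (the residual class shrinks, the simple class grows)
  set b' := max b 4 with hb'
  refine ⟨b' + 1, max n₀ 4, fun n hn E hE hE0 => ?_⟩
  have hn₀ : n₀ ≤ n := le_trans (le_max_left _ _) hn
  have hn4 : 4 ≤ n := le_trans (le_max_right _ _) hn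
  obtain ⟨hE4, hhom⟩ := hE
  by_contra hnot
  push Not at hnot
  -- `E` is a homogeneous level-4 equation for `SmallCircuits ℂ n (b'+1)`
  have hvan : ∀ f ∈ SmallCircuits ℂ n (b' + 1), eval (coeffVector (degLEMonomials n) f) E = 0 :=
    fun f hf => hnot f hf
  obtain ⟨F, hF, hF0, hFhom, hFiso, hFvan⟩ :=
    exists_isobaric_equation hn4 (le_trans (by norm_num) (le_max_right b 4)) hE4 hhom hE0 hvan
  -- `F` is an equation of `SmallCircuits ℂ n b'`, hence super-dense
  have hdense : 2 ^ (n ^ (b' - 3)) < F.support.card :=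
    Sparse.two_pow_pow_lt_card_support_of_vanishes hn4 (le_max_right b 4) hF0 hFvan
  have hdense_b : 2 ^ (n ^ (b - 3)) < F.support.card :=
    lt_of_le_of_lt (Nat.pow_le_pow_right (by norm_num)
      (Nat.pow_le_pow_right (by omega) (by omega))) hdense
  -- `F` is hit at exponent `b`: contradiction
  obtain ⟨f, hf, hne⟩ := hb n hn₀ F ⟨⟨⟨hF, hFhom⟩, hFiso⟩, hdense_b⟩ hF0
  exact hne (hFvan f (smallCircuits_mono ℂ (le_max_left b 4) (by omega) hf))

/-- **The crux is equivalent to its bihomogeneous super-dense level-sixteen case**: FSV Question 6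
over `ℂ` (regime `d = n`) holds iff for some `b`, eventually in `n`, the coefficient vectors of
`SmallCircuits ℂ n b` hit every nonzero distinguisher of size and degree `≤ N¹⁶` that is
homogeneous, isobaric for the weight `c_μ ↦ |μ|`, and has more than `2^(n^(b-3))` monomials:
equations for `VP` may be assumed bihomogeneous and super-dense.
[cite: ForbesShpilkaVolk2018, Question 6] -/
theorem succinctHittingSetsForVP_iff_isobaric :
    Summit.ValiantsHypothesis.ValiantsHypothesis.Theses.BarrierLever.SuccinctHittingSetsForVP ↔
      ∃ b n₀ : ℕ, ∀ n : ℕ, n₀ ≤ n →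
        IsSuccinctHittingSet (degLEMonomials n) (SmallCircuits ℂ n b)
          (Distinguishers ℂ n 16 ∩ {D | D.IsHomogeneous D.totalDegree} ∩
            {D | ∃ k : ℕ, D.IsWeightedHomogeneous
              (fun μ : degLEMonomials n => (μ : Fin n →₀ ℕ).degree) k} ∩
            {D | 2 ^ (n ^ (b - 3)) < D.support.card}) := by
  constructor
  · intro h
    obtain ⟨b, n₀, hb⟩ :=
      (show Literature.Barriers.ValiantsHypothesis.SuccinctHittingSetsForVP ℂ from h) 16
    exact ⟨b, n₀, fun n hn => (hb n hn).mono le_rfl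
      ((Set.inter_subset_left.trans Set.inter_subset_left).trans Set.inter_subset_left)⟩
  · intro h
    exact succinctHittingSetsForVP_iff_homogeneous.mpr (levelFourHomogeneous_of_isobaric h)

/-- **Registered stub `stub_isobaricReduction`** (crux stmt-ValiantsHypothesis-14610, line
`registered`, wave 8): the bihomogeneous super-dense level-sixteen case implies the homogeneous
level-four case (arrow form; `levelFourHomogeneous_of_isobaric`).
[cite: ForbesShpilkaVolk2018, Question 6] -/
theorem stub_isobaricReduction :
    (∃ b n₀ : ℕ, ∀ n : ℕ, n₀ ≤ n →
      IsSuccinctHittingSet (degLEMonomials n) (SmallCircuits ℂ n b)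
        (Distinguishers ℂ n 16 ∩ {D | D.IsHomogeneous D.totalDegree} ∩
          {D | ∃ k : ℕ, D.IsWeightedHomogeneous (fun μ : degLEMonomials n => (μ : Fin n →₀ ℕ).degree) k} ∩
          {D | 2 ^ (n ^ (b - 3)) < D.support.card})) →
    ∃ b n₀ : ℕ, ∀ n : ℕ, n₀ ≤ n →
      IsSuccinctHittingSet (degLEMonomials n) (SmallCircuits ℂ n b)
        (Distinguishers ℂ n 4 ∩ {D | D.IsHomogeneous D.totalDegree}) :=
  levelFourHomogeneous_of_isobaric

end Summit.ValiantsHypothesis.ValiantsHypothesis.Theorems.BarrierLever.SuccinctHittingSetsForVP
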